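import Mathlib
import HarnessLib
import Summits.AnomalousDissipation.AnomalousDissipation.Theses.DecimationAxis
import Literature.Analysis.FluidPDE.GalerkinFlow
import Literature.Analysis.FluidPDE.LongTimeAverageShift
import Literature.Analysis.FluidPDE.TimeAverageMeasureBasic

/-!
# Stub-ideation sketch (ideator 3, FAMILY 3 — probe the extremes) for `stub_absorbedWitness`
of the birth skeleton of crux `DecimationAxis.UniformEquilibration` (stmt-AnomalousDissipation-1583).

Helper-lemma SIGNATURES (sorried: A1a, A1, A2, A3c) + the kernel-checked ASSEMBLY
`absorbedWitness_of_helpers : Sig.stub_absorbedWitness` from them (no sorry of its own), to certify that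
the helpers imply the stub verbatim. Vocabulary copied from `Cruxes/UniformEquilibration/Lines/birth.lean` §0–§1.
-/

set_option linter.dupNamespace false

noncomputable section

namespace Summit.AnomalousDissipation.AnomalousDissipation.Cruxes.UniformEquilibration.StubIdeas3

open scoped BigOperators Topology Classical MeasureTheory InnerProductSpace ComplexConjugate
open Filter Set Function MeasureTheory
open Literature.Analysis.FunctionSpaces Literature.Analysis.FunctionSpaces.Torus
open Literature.Analysis.FluidPDE
open Summit.AnomalousDissipation.AnomalousDissipation.Theses.DecimationAxis

/-- Integer frequencies (local notation). -/
local notation "ℤ³" => Fin 3 → ℤ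
/-- Complex Fourier coefficient vectors (local notation). -/
local notation "ℂ³" => EuclideanSpace ℂ (Fin 3)

/-! ### §0 Vocabulary (verbatim from `Lines/birth.lean`) -/

def IsCoeffTrajectory (S : Finset ℤ³) (ν : ℝ) (g : ℤ³ → ℂ³) (c : ℝ → ↥S → ℂ³) : Prop :=
  (∀ t, c t ∈ galerkinSubspace S) ∧ ContinuousOn c (Set.Ici 0) ∧
    ∀ T : ℝ, ∀ t ∈ Set.Icc (0 : ℝ) T,
      HasDerivWithinAt c (galerkinRHS S ν (fun k => g k) (c t)) (Set.Icc 0 T) t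

def modalEnergy {S : Finset ℤ³} (a : ↥S → ℂ³) : ℝ :=
  ∑ k : ↥S, ‖a k‖ ^ 2

def resolvedDissipation {S : Finset ℤ³} (ν : ℝ) (M : ℕ) (a : ↥S → ℂ³) : ℝ :=
  ν * (4 * Real.pi ^ 2 * ∑ k : ↥S,
    if freqNormSq (k : ℤ³) ≤ (M : ℝ) ^ 2 then freqNormSq (k : ℤ³) * ‖a k‖ ^ 2 else 0)

def Sig.stub_absorbedWitness : Prop :=
  ∀ (ν : ℝ), 0 < ν → ∀ (N : ℕ) (g : ℤ³ → ℂ³), IsConjSymm g → (∀ k, k ∉ freqBall N → g k = 0) →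
    g 0 = 0 → (∀ k : ℤ³, ∑ i, ((k i : ℤ) : ℂ) * g k i = 0) →
    ∃ B : ℝ, ∀ (E ε : ℝ) (M K : ℕ) (S : Finset ℤ³), S = (freqBall K).erase 0 →
      (∃ c : ℝ → ↥S → ℂ³, IsCoeffTrajectory S ν g c ∧
          longTimeAvgSup (fun t => modalEnergy (c t)) ≤ E ∧
          2 * ε ≤ longTimeAvgInf (fun t => resolvedDissipation ν M (c t))) →
      ∃ c : ℝ → ↥S → ℂ³, IsCoeffTrajectory S ν g c ∧ (∀ t, 0 ≤ t → modalEnergy (c t) ≤ B) ∧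
          longTimeAvgSup (fun t => modalEnergy (c t)) ≤ E ∧
          2 * ε ≤ longTimeAvgInf (fun t => resolvedDissipation ν M (c t))

/-! ### §1 Helper lemmas of PLAN A (extremal scalar comparison = Grönwall with negative rate) -/

/-- **A0 (Mathlib wrapper, proved).** Grönwall with a SIGNED rate in right-derivative form:
`f' ≤ K f + ε` on `[a,b)` ⇒ `f x ≤ gronwallBound δ K ε (x - a)`; `K < 0` allowed. -/
theorem le_gronwallBound_of_deriv_right_le {f f' : ℝ → ℝ} {δ K ε a b : ℝ}
    (hf : ContinuousOn f (Icc a b)) (hf' : ∀ x ∈ Ico a b, HasDerivWithinAt f (f' x) (Ici x) x)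
    (ha : f a ≤ δ) (bound : ∀ x ∈ Ico a b, f' x ≤ K * f x + ε) :
    ∀ x ∈ Icc a b, f x ≤ gronwallBound δ K ε (x - a) :=
  le_gronwallBound_of_liminf_deriv_right_le hf
    (fun x hx _r hr => (hf' x hx).liminf_right_slope_le hr) ha bound

/-- **A0' (proved): the Grönwall majorant with negative rate is below `δe^{-ax} + ε/a`.** -/
theorem gronwallBound_neg_le {δ a ε x : ℝ} (ha : 0 < a) (hε : 0 ≤ ε) (hx : 0 ≤ x) :
    gronwallBound δ (-a) ε x ≤ δ * Real.exp (-a * x) + ε / a := by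
  rw [gronwallBound_of_K_ne_0 (neg_ne_zero.2 ha.ne')]
  dsimp only
  have h1 : 0 < Real.exp (-a * x) := Real.exp_pos _
  have h2 : Real.exp (-a * x) ≤ 1 := by rw [Real.exp_le_one_iff]; nlinarith
  have h3 : ε / (-a) * (Real.exp (-a * x) - 1) = ε / a * (1 - Real.exp (-a * x)) := by
    field_simp; ring
  rw [h3]
  have h4 : 0 ≤ ε / a := div_nonneg hε ha.le
  nlinarith [mul_le_mul_of_nonneg_left h2 h4]

/-- **A1a (slice inequality on `S ∌ 0`).** Energy flux `≤ -(4π²ν)·Σ‖c_k‖² + Φ²/(4π²ν)`: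
Poincaré `|k|² ≥ 1` on `S ∌ 0` (`toReal_eGradNormSq_coeffExt`, `one_le_freqNormSq_of_ne_zero`) and
termwise Young `2Re⟪g_k,c_k⟫ ≤ ‖g_k‖²/(4π²ν) + 4π²ν‖c_k‖²` (`integral_inner_realTrigPoly_realTrigPoly`,
pattern of the tree's `energy_deriv_le`). -/
theorem energyFlux_le {S : Finset ℤ³} (hS : ∀ k ∈ S, -k ∈ S) (h0 : (0 : ℤ³) ∉ S) {ν : ℝ}
    (hν : 0 < ν) {g c : ↥S → ℂ³} (hg : IsRealCoeff g) (hc : c ∈ galerkinSubspace S) {Φsq : ℝ}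
    (hgΦ : ∑ k, ‖g k‖ ^ 2 ≤ Φsq) :
    2 * (-(ν * (eGradNormSq (realTrigPoly S (coeffExt S c))).toReal) +
        ∫ x, ⟪realTrigPoly S (coeffExt S g) x, realTrigPoly S (coeffExt S c) x⟫_ℝ) ≤
      -(4 * Real.pi ^ 2 * ν) * (∑ k, ‖c k‖ ^ 2) + Φsq / (4 * Real.pi ^ 2 * ν) := by
  sorry

/-- **A1 (K-uniform exponential entrance + confinement, the extremal comparison).** Along a global
Galerkin solution on a symmetric `S ∌ 0`, `ν > 0`, real force with `Σ‖g_k‖² ≤ Φ²`: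
`Σ‖α t k‖² ≤ Σ‖c₀ k‖²·e^{-4π²ν t} + Φ²/(4π²ν)²` for `t ≥ 0` — `hasDerivWithinAt_energy` + A1a feed
A0 on `[0,t]` with `K = -4π²ν`, `ε = Φ²/(4π²ν)`, `δ = Σ‖c₀ k‖²`; `gronwallBound_of_K_ne_0`, drop the
negative `-(ε/|K|)e^{Kt}` term. -/
theorem modalEnergy_le_exp {S : Finset ℤ³} (hS : ∀ k ∈ S, -k ∈ S) (h0 : (0 : ℤ³) ∉ S) {ν : ℝ}
    (hν : 0 < ν) {g c₀ : ↥S → ℂ³} {α : ℝ → ↥S → ℂ³} (hg : IsRealCoeff g)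
    (hsol : IsGalerkinODESolution ν g c₀ α) {Φsq : ℝ} (hgΦ : ∑ k, ‖g k‖ ^ 2 ≤ Φsq) {t : ℝ}
    (ht : 0 ≤ t) :
    ∑ k, ‖α t k‖ ^ 2 ≤
      (∑ k, ‖c₀ k‖ ^ 2) * Real.exp (-(4 * Real.pi ^ 2 * ν) * t) +
        Φsq / (4 * Real.pi ^ 2 * ν) ^ 2 := by
  sorry

/-- **A2 (liminf twin of `longTimeAvgSup_comp_add_right` for BOUNDED observables).** For `|φ| ≤ M` on
`[0,∞)`, locally integrable, `s ≥ 0`: `longTimeAvgInf (φ(·+s)) = longTimeAvgInf φ`. Proof: the difference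
of running means → 0 (copy the tree's 30-line `stub_invariantMeasure_aux_timeMean_shift_tendsto`,
Theorems/MarginalStabilityChainChainRealisationStubInvariantMeasure.lean — do not import it, heavy chain),
both families bounded by `M` (`abs_timeMean_le`), then Mathlib `le_liminf_add` / `liminf_add_le` +
`Tendsto.liminf_eq/limsup_eq`. -/
theorem longTimeAvgInf_comp_add_right_of_abs_le {φ : ℝ → ℝ} {s M : ℝ} (hs : 0 ≤ s)
    (hM : ∀ t, 0 ≤ t → |φ t| ≤ M)
    (hint : ∀ a b : ℝ, 0 ≤ a → a ≤ b → IntervalIntegrable φ volume a b) :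
    longTimeAvgInf (fun t => φ (t + s)) = longTimeAvgInf φ := by
  sorry

/-! ### §2 Bookkeeping (A3) -/

/-- A3a: the crux's solution notion is `IsGalerkinODESolution` minus the `rfl` datum clause. -/
theorem isCoeffTrajectory_iff {S : Finset ℤ³} {ν : ℝ} {g : ℤ³ → ℂ³} {c : ℝ → ↥S → ℂ³} :
    IsCoeffTrajectory S ν g c ↔ IsGalerkinODESolution ν (fun k : ↥S => g k) (c 0) c :=
  ⟨fun h => ⟨rfl, h.1, h.2.1, h.2.2⟩, fun h => ⟨h.mem, h.continuousOn, h.hasDerivWithinAt⟩⟩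

/-- A3b: autonomy — time shifts of trajectories are trajectories (`IsGalerkinODESolution.comp_add`). -/
theorem IsCoeffTrajectory.comp_add {S : Finset ℤ³} {ν : ℝ} {g : ℤ³ → ℂ³} {c : ℝ → ↥S → ℂ³}
    (hc : IsCoeffTrajectory S ν g c) {s : ℝ} (hs : 0 ≤ s) :
    IsCoeffTrajectory S ν g (fun t => c (t + s)) := by
  have h := (isCoeffTrajectory_iff.1 hc).comp_add hs
  exact ⟨h.mem, h.continuousOn, h.hasDerivWithinAt⟩

/-- A3c: the force seen by any truncation is bounded by the full band energy `Σ_{freqBall N}‖g k‖²`. -/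
theorem sum_norm_sq_restrict_le {N : ℕ} {g : ℤ³ → ℂ³} (hsupp : ∀ k, k ∉ freqBall N → g k = 0)
    (S : Finset ℤ³) : ∑ k : ↥S, ‖g k‖ ^ 2 ≤ ∑ k ∈ freqBall N, ‖g k‖ ^ 2 := by
  sorry

/-- A3d: symmetry and mean-freeness of the punctured ball. -/
theorem neg_mem_of_mem_erase_freqBall {K : ℕ} :
    ∀ k ∈ (freqBall (d := Fin 3) K).erase 0, -k ∈ (freqBall (d := Fin 3) K).erase 0 := by
  intro k hk
  rw [Finset.mem_erase] at hk ⊢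
  exact ⟨neg_ne_zero.2 hk.1, neg_mem_freqBall_of_mem k hk.2⟩

/-- A3e: continuity of the two observables along a trajectory (for interval integrability). -/
theorem continuousOn_modalEnergy {S : Finset ℤ³} {c : ℝ → ↥S → ℂ³} (hc : ContinuousOn c (Ici 0)) :
    ContinuousOn (fun t => modalEnergy (c t)) (Ici 0) := by
  unfold modalEnergy
  refine continuousOn_finsetSum _ fun k _ => ?_
  exact (((continuous_apply k).comp_continuousOn hc).norm).pow 2

theorem continuousOn_resolvedDissipation {S : Finset ℤ³} (ν : ℝ) (M : ℕ) {c : ℝ → ↥S → ℂ³}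
    (hc : ContinuousOn c (Ici 0)) :
    ContinuousOn (fun t => resolvedDissipation ν M (c t)) (Ici 0) := by
  unfold resolvedDissipation
  refine continuousOn_const.mul (continuousOn_const.mul (continuousOn_finsetSum _ fun k _ => ?_))
  by_cases hk : freqNormSq (k : ℤ³) ≤ (M : ℝ) ^ 2
  · simp only [if_pos hk]
    exact continuousOn_const.mul ((((continuous_apply k).comp_continuousOn hc).norm).pow 2)
  · simp only [if_neg hk]
    exact continuousOn_const

theorem resolvedDissipation_nonneg {S : Finset ℤ³} {ν : ℝ} (hν : 0 ≤ ν) (M : ℕ) (a : ↥S → ℂ³) :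
    0 ≤ resolvedDissipation ν M a := by
  unfold resolvedDissipation
  refine mul_nonneg hν (mul_nonneg (by positivity) (Finset.sum_nonneg fun k _ => ?_))
  split_ifs
  · exact mul_nonneg (freqNormSq_nonneg _) (sq_nonneg _)
  · exact le_rfl

/-- A3f: resolved dissipation is controlled by `M²` times the energy (K-uniform bound inside the ball). -/
theorem resolvedDissipation_le {S : Finset ℤ³} {ν : ℝ} (hν : 0 ≤ ν) (M : ℕ) (a : ↥S → ℂ³) :
    resolvedDissipation ν M a ≤ ν * (4 * Real.pi ^ 2 * ((M : ℝ) ^ 2 * modalEnergy a)) := by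
  unfold resolvedDissipation modalEnergy
  refine mul_le_mul_of_nonneg_left (mul_le_mul_of_nonneg_left ?_ (by positivity)) hν
  rw [Finset.mul_sum]
  refine Finset.sum_le_sum fun k _ => ?_
  split_ifs with hk
  · exact mul_le_mul_of_nonneg_right hk (sq_nonneg _)
  · positivity

/-- interval integrability of a function continuous on `[0, ∞)` over `[a, b] ⊆ [0, ∞)`. -/
theorem intervalIntegrable_of_continuousOn_Ici {φ : ℝ → ℝ} (hφ : ContinuousOn φ (Ici 0)) {a b : ℝ}
    (ha : 0 ≤ a) (hab : a ≤ b) : IntervalIntegrable φ volume a b :=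
  (hφ.mono (by rw [uIcc_of_le hab]; exact fun t ht => ha.trans ht.1)).intervalIntegrable

/-! ### §3 Assembly: the helpers give the stub verbatim -/

theorem absorbedWitness_of_helpers : Sig.stub_absorbedWitness := by
  intro ν hν N g hcs hsupp hg0 htr
  have ha : 0 < 4 * Real.pi ^ 2 * ν := by positivity
  refine ⟨(∑ k ∈ freqBall N, ‖g k‖ ^ 2) / (4 * Real.pi ^ 2 * ν) ^ 2 + 1, ?_⟩
  intro E ε M K S hS hprem
  obtain ⟨c, hc, hsup, hinf⟩ := hprem
  -- structure of `S`
  have hSsymm : ∀ k ∈ S, -k ∈ S := by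
    rw [hS]; exact neg_mem_of_mem_erase_freqBall
  have h0S : (0 : ℤ³) ∉ S := by rw [hS]; simp
  have hgr : IsRealCoeff (S := S) (fun k => g k) := isRealCoeff_restrict hcs
  have hgG : ∑ k : ↥S, ‖g k‖ ^ 2 ≤ ∑ k ∈ freqBall N, ‖g k‖ ^ 2 := sum_norm_sq_restrict_le hsupp S
  have hsol : IsGalerkinODESolution ν (fun k : ↥S => g k) (c 0) c := isCoeffTrajectory_iff.1 hc
  set Gsq : ℝ := ∑ k ∈ freqBall N, ‖g k‖ ^ 2 with hGsq
  set ψ0 : ℝ := ∑ k, ‖c 0 k‖ ^ 2 with hψ0_def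
  have hψ0 : 0 ≤ ψ0 := Finset.sum_nonneg fun _ _ => sq_nonneg _
  have hGsq0 : 0 ≤ Gsq := Finset.sum_nonneg fun _ _ => sq_nonneg _
  -- A1 along `c`
  have hdecay : ∀ t, 0 ≤ t → modalEnergy (c t) ≤
      ψ0 * Real.exp (-(4 * Real.pi ^ 2 * ν) * t) + Gsq / (4 * Real.pi ^ 2 * ν) ^ 2 :=
    fun t ht => modalEnergy_le_exp hSsymm h0S hν hgr hsol hgG ht
  have hbound0 : ∀ t, 0 ≤ t → modalEnergy (c t) ≤ ψ0 + Gsq / (4 * Real.pi ^ 2 * ν) ^ 2 := by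
    intro t ht
    have h1 : Real.exp (-(4 * Real.pi ^ 2 * ν) * t) ≤ 1 := by
      rw [Real.exp_le_one_iff]; nlinarith
    have h2 := mul_le_mul_of_nonneg_left h1 hψ0
    linarith [hdecay t ht]
  -- explicit entrance time `t₀ = ψ0 / (4π²ν)`: `ψ0 · e^{-ψ0} ≤ 1`
  set t₀ : ℝ := ψ0 / (4 * Real.pi ^ 2 * ν) with ht₀_def
  have ht₀ : 0 ≤ t₀ := div_nonneg hψ0 ha.le
  have hkey : ψ0 * Real.exp (-(4 * Real.pi ^ 2 * ν) * t₀) ≤ 1 := by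
    have h1 : -(4 * Real.pi ^ 2 * ν) * t₀ = -ψ0 := by
      rw [ht₀_def]; field_simp
    rw [h1]
    have h2 : ψ0 + 1 ≤ Real.exp ψ0 := Real.add_one_le_exp ψ0
    have h3 : Real.exp (-ψ0) * Real.exp ψ0 = 1 := by rw [← Real.exp_add]; simp
    have h4 : 0 < Real.exp (-ψ0) := Real.exp_pos _
    nlinarith
  refine ⟨fun t => c (t + t₀), hc.comp_add ht₀, ?_, ?_, ?_⟩
  · -- confinement in the K-uniform ball from time 0
    intro t ht
    have h := hdecay (t + t₀) (by positivity)
    have hmono : Real.exp (-(4 * Real.pi ^ 2 * ν) * (t + t₀)) ≤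
        Real.exp (-(4 * Real.pi ^ 2 * ν) * t₀) := Real.exp_le_exp.2 (by nlinarith)
    have h2 := mul_le_mul_of_nonneg_left hmono hψ0
    show modalEnergy (c (t + t₀)) ≤ Gsq / (4 * Real.pi ^ 2 * ν) ^ 2 + 1
    linarith
  · -- `limsup` energy: shift invariance (tree)
    have heq := longTimeAvgSup_comp_add_right (φ := fun t => modalEnergy (c t)) (s := t₀)
      (fun t => Finset.sum_nonneg fun _ _ => sq_nonneg _) ht₀
      (fun a b ha' hab => intervalIntegrable_of_continuousOn_Ici (continuousOn_modalEnergy hc.2.1) ha' hab)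
    exact heq.trans_le hsup
  · -- `liminf` resolved dissipation: bounded observable, A2
    have hbd : ∀ t, 0 ≤ t → |resolvedDissipation ν M (c t)| ≤
        ν * (4 * Real.pi ^ 2 * ((M : ℝ) ^ 2 * (ψ0 + Gsq / (4 * Real.pi ^ 2 * ν) ^ 2))) := by
      intro t ht
      rw [abs_of_nonneg (resolvedDissipation_nonneg hν.le M (c t))]
      refine (resolvedDissipation_le hν.le M (c t)).trans ?_
      gcongr
      exact hbound0 t ht
    have heq := longTimeAvgInf_comp_add_right_of_abs_le (φ := fun t => resolvedDissipation ν M (c t))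
      ht₀ hbd (fun a b ha' hab =>
        intervalIntegrable_of_continuousOn_Ici (continuousOn_resolvedDissipation ν M hc.2.1) ha' hab)
    exact hinf.trans_eq heq.symm

end Summit.AnomalousDissipation.AnomalousDissipation.Cruxes.UniformEquilibration.StubIdeas3

end
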